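import Mathlib.Analysis.Calculus.InverseFunctionTheorem.ContDiff
import Mathlib.Analysis.Calculus.BumpFunction.FiniteDimension
import Mathlib.Analysis.Calculus.ContDiff.RCLike
import Mathlib.Analysis.SpecialFunctions.SmoothTransition
import Summits.AtomisticToContinuum.FouriersLaw.Theorems.FGRGap.Negative.LoadBearing

/-!
# FGRGap, line fold-jet-rigidity, stub S2 (averaging bootstrap) — file B:
# the inverse chart of `(a, y) ↦ (a, Φ (a, y))` and the pulled-back smooth kernel

Support file for `stub_nullVectorRegularity` of crux `EmbeddedDrudeMourre.FGRGap`
(item stmt-AtomisticToContinuum-12595). Pure calculus in the plane: for `Φ : ℝ × ℝ → ℝ` smooth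
near `p₀` with `∂₂Φ(p₀) ≠ 0`, the map `Ψ (a, y) = (a, Φ (a, y))` is a local diffeomorphism
(inverse function theorem); on a small box around `p₀` the sign of `∂₂Φ` is constant, the slices
`Φ (a, ·)` are injective, and for every smooth `χ` supported in the `y`-window there is a smooth,
bounded, compactly `u`-supported kernel `Θ (a, u)` with `Θ (a, Φ (a, y)) · |∂₂Φ (a, y)| = χ y` —
the Jacobian factor of the substitution `u = Φ (a, y)` in `∫ χ (y) f (Φ (a, y)) dy`.
-/

noncomputable section

open MeasureTheory Set Real Filter Topology Metric
open scoped ENNReal ContDiff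
open Literature.MathematicalPhysics.KineticTheory.PhononBoltzmann
open Summit.AtomisticToContinuum.FouriersLaw.Theorems.FGRGap

namespace Summit.AtomisticToContinuum.FouriersLaw.Theorems.FGRGap.FoldJetRigidity.Bootstrap

/-! ## Linear algebra in the plane -/

/-- A continuous linear functional on `ℝ²` is determined by its values on the basis vectors. -/
theorem clm_apply_eq (L : ℝ × ℝ →L[ℝ] ℝ) (w : ℝ × ℝ) :
    L w = L (1, 0) * w.1 + L (0, 1) * w.2 := by
  have hw : w = w.1 • ((1 : ℝ), (0 : ℝ)) + w.2 • ((0 : ℝ), (1 : ℝ)) := by ext <;> simp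
  conv_lhs => rw [hw]
  rw [map_add, map_smul, map_smul, smul_eq_mul, smul_eq_mul]
  ring

/-- The shear `(u, v) ↦ (u, c u + d v)` is a continuous linear automorphism of `ℝ²` for `d ≠ 0`. -/
theorem exists_shear_equiv (c d : ℝ) (hd : d ≠ 0) :
    ∃ e : (ℝ × ℝ) ≃L[ℝ] (ℝ × ℝ), ∀ w : ℝ × ℝ, e w = (w.1, c * w.1 + d * w.2) := by
  refine ⟨ContinuousLinearEquiv.equivOfInverse
    ((ContinuousLinearMap.fst ℝ ℝ ℝ).prod
      (c • ContinuousLinearMap.fst ℝ ℝ ℝ + d • ContinuousLinearMap.snd ℝ ℝ ℝ))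
    ((ContinuousLinearMap.fst ℝ ℝ ℝ).prod
      ((-c / d) • ContinuousLinearMap.fst ℝ ℝ ℝ + d⁻¹ • ContinuousLinearMap.snd ℝ ℝ ℝ))
    (fun w => ?_) (fun w => ?_), fun w => ?_⟩
  · ext
    · simp
    · simp only [ContinuousLinearMap.prod_apply, ContinuousLinearMap.coe_fst',
        add_apply, FunLike.coe_smul, Pi.smul_apply,
        ContinuousLinearMap.coe_snd', smul_eq_mul]
      field_simp
      ring
  · ext
    · simp
    · simp only [ContinuousLinearMap.prod_apply, ContinuousLinearMap.coe_fst',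
        add_apply, FunLike.coe_smul, Pi.smul_apply,
        ContinuousLinearMap.coe_snd', smul_eq_mul]
      field_simp
      ring
  · simp [smul_eq_mul]

/-- The derivative of `Ψ (a, y) = (a, Φ (a, y))` is a shear, invertible when `∂₂Φ ≠ 0`. -/
theorem exists_equiv_hasFDerivAt_graph {Φ : ℝ × ℝ → ℝ} {q : ℝ × ℝ} {L : ℝ × ℝ →L[ℝ] ℝ}
    (hΦ : HasFDerivAt Φ L q) (hL : L (0, 1) ≠ 0) :
    ∃ e : (ℝ × ℝ) ≃L[ℝ] (ℝ × ℝ),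
      HasFDerivAt (fun p : ℝ × ℝ => (p.1, Φ p)) (e : ℝ × ℝ →L[ℝ] ℝ × ℝ) q := by
  obtain ⟨e, he⟩ := exists_shear_equiv (L (1, 0)) (L (0, 1)) hL
  refine ⟨e, (hasFDerivAt_fst.prodMk hΦ).congr_fderiv (ContinuousLinearMap.ext fun w => ?_)⟩
  rw [ContinuousLinearEquiv.coe_coe, he, ContinuousLinearMap.prod_apply,
    ContinuousLinearMap.coe_fst', clm_apply_eq L w]

/-! ## The inverse chart -/

/-- **The inverse chart.** For `Φ` smooth on an open `V ∋ p₀` with `∂₂Φ (p₀) ≠ 0` there are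
`ε > 0` and a local homeomorphism `e` of the plane with `e = (fst, Φ)`, defined on the open
`ε`-box around `p₀`, whose closure lies in `V` and on which `∂₂Φ` has the sign of `∂₂Φ (p₀)`,
and with `e.symm` smooth at every point of the image of the box. -/
theorem exists_inverse_chart {Φ : ℝ × ℝ → ℝ} {p₀ : ℝ × ℝ} {V : Set (ℝ × ℝ)} (hV : IsOpen V)
    (hp₀ : p₀ ∈ V) (hΦ : ContDiffOn ℝ ∞ Φ V) (h2 : fderiv ℝ Φ p₀ (0, 1) ≠ 0) :
    ∃ ε : ℝ, 0 < ε ∧ ∃ e : OpenPartialHomeomorph (ℝ × ℝ) (ℝ × ℝ),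
      closedBall p₀ ε ⊆ V ∧ ball p₀ ε ⊆ e.source ∧ (∀ q, e q = (q.1, Φ q)) ∧
      (∀ q ∈ closedBall p₀ ε, 0 < fderiv ℝ Φ p₀ (0, 1) * fderiv ℝ Φ q (0, 1)) ∧
      (∀ q ∈ e.target, e.symm q ∈ ball p₀ ε → ContDiffAt ℝ ∞ e.symm q) := by
  have htop : (∞ : WithTop ℕ∞) ≠ 0 := by simp
  have hΦat : ∀ q ∈ V, ContDiffAt ℝ ∞ Φ q := fun q hq => hΦ.contDiffAt (hV.mem_nhds hq)
  have hdiff : ∀ q ∈ V, HasFDerivAt Φ (fderiv ℝ Φ q) q := fun q hq =>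
    ((hΦat q hq).differentiableAt htop).hasFDerivAt
  set Ψ : ℝ × ℝ → ℝ × ℝ := fun q => (q.1, Φ q) with hΨ
  have hΨat : ∀ q ∈ V, ContDiffAt ℝ ∞ Ψ q := fun q hq => contDiffAt_fst.prodMk (hΦat q hq)
  obtain ⟨e₀, he₀⟩ := exists_equiv_hasFDerivAt_graph (hdiff p₀ hp₀) h2
  set e := (hΨat p₀ hp₀).toOpenPartialHomeomorph Ψ he₀ htop with he_def
  have he_coe : ∀ q, e q = (q.1, Φ q) := fun q => rfl
  have hsrc : p₀ ∈ e.source := (hΨat p₀ hp₀).mem_toOpenPartialHomeomorph_source he₀ htop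
  -- continuity of `∂₂Φ` on `V`
  have hcont : ContinuousOn (fun q => fderiv ℝ Φ p₀ (0, 1) * fderiv ℝ Φ q (0, 1)) V :=
    continuousOn_const.mul
      ((hΦ.continuousOn_fderiv_of_isOpen hV (by simp)).clm_apply continuousOn_const)
  set G : Set (ℝ × ℝ) := e.source ∩
    (V ∩ (fun q => fderiv ℝ Φ p₀ (0, 1) * fderiv ℝ Φ q (0, 1)) ⁻¹' Ioi 0) with hG
  have hGopen : IsOpen G := e.open_source.inter (hcont.isOpen_inter_preimage hV isOpen_Ioi)
  have hp₀G : p₀ ∈ G := ⟨hsrc, hp₀, by simpa using mul_self_pos.2 h2⟩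
  obtain ⟨ε₁, hε₁, hball⟩ := Metric.isOpen_iff.1 hGopen p₀ hp₀G
  have hcb : closedBall p₀ (ε₁ / 2) ⊆ G :=
    (closedBall_subset_ball (by linarith)).trans hball
  refine ⟨ε₁ / 2, by positivity, e, fun q hq => (hcb hq).2.1,
    ball_subset_closedBall.trans fun q hq => (hcb hq).1, he_coe, fun q hq => (hcb hq).2.2, ?_⟩
  intro q hq hqb
  have hq' : e.symm q ∈ G := hcb (ball_subset_closedBall hqb)
  have hne : fderiv ℝ Φ (e.symm q) (0, 1) ≠ 0 := by
    intro h0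
    have := hq'.2.2
    simp [h0] at this
  obtain ⟨e₁, he₁⟩ := exists_equiv_hasFDerivAt_graph (hdiff _ hq'.2.1) hne
  exact e.contDiffAt_symm hq he₁ (hΨat _ hq'.2.1)

/-! ## The pulled-back kernel -/

/-- **The smooth kernel of the substitution `u = Φ (a, y)`.** In the situation of
`exists_inverse_chart`, for every smooth `χ` with compact support inside the `y`-window
`(p₀.2 - ε, p₀.2 + ε)` there is a smooth bounded kernel `Θ` on the plane, vanishing unless
`u ∈ Φ (closedBall p₀ ε)`, such that for `a` in the half-window `(p₀.1 - ε/2, p₀.1 + ε/2)`: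
`Θ (a, Φ (a, y)) · |∂₂Φ (a, y)| = χ y` for `y` in the window, and `Θ (a, u) ≠ 0` only for `u` in
the image `Φ (a, window)`. -/
theorem exists_kernel {Φ : ℝ × ℝ → ℝ} {p₀ : ℝ × ℝ} {V : Set (ℝ × ℝ)} (hV : IsOpen V)
    (hΦ : ContDiffOn ℝ ∞ Φ V) {ε : ℝ} (hε : 0 < ε) (e : OpenPartialHomeomorph (ℝ × ℝ) (ℝ × ℝ))
    (hεV : closedBall p₀ ε ⊆ V) (hsrc : ball p₀ ε ⊆ e.source) (he : ∀ q, e q = (q.1, Φ q))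
    (hpos : ∀ q ∈ closedBall p₀ ε, 0 < fderiv ℝ Φ p₀ (0, 1) * fderiv ℝ Φ q (0, 1))
    (hsymm : ∀ q ∈ e.target, e.symm q ∈ ball p₀ ε → ContDiffAt ℝ ∞ e.symm q)
    {χ : ℝ → ℝ} (hχ : ContDiff ℝ ∞ χ) (hχc : HasCompactSupport χ)
    (hχs : tsupport χ ⊆ Ioo (p₀.2 - ε) (p₀.2 + ε)) :
    ∃ Θ : ℝ × ℝ → ℝ, ContDiff ℝ ∞ Θ ∧ (∀ q, Θ q ≠ 0 → q.2 ∈ Φ '' closedBall p₀ ε) ∧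
      (∃ C, ∀ q, |Θ q| ≤ C) ∧
      (∀ a ∈ Ioo (p₀.1 - ε / 2) (p₀.1 + ε / 2), ∀ y ∈ Ioo (p₀.2 - ε) (p₀.2 + ε),
        Θ (a, Φ (a, y)) * |fderiv ℝ Φ (a, y) (0, 1)| = χ y) ∧
      (∀ a ∈ Ioo (p₀.1 - ε / 2) (p₀.1 + ε / 2), ∀ u : ℝ, Θ (a, u) ≠ 0 →
        u ∈ (fun y => Φ (a, y)) '' Ioo (p₀.2 - ε) (p₀.2 + ε)) := by
  have htop : (∞ : WithTop ℕ∞) ≠ 0 := by simp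
  -- notation
  set d : ℝ := fderiv ℝ Φ p₀ (0, 1) with hd
  set D : ℝ × ℝ → ℝ := fun q => fderiv ℝ Φ q (0, 1) with hD
  set I : Set ℝ := Ioo (p₀.1 - ε) (p₀.1 + ε) with hI
  set J : Set ℝ := Ioo (p₀.2 - ε) (p₀.2 + ε) with hJ
  have hbox : ball p₀ ε = I ×ˢ J := by
    rw [hI, hJ, ← Real.ball_eq_Ioo, ← Real.ball_eq_Ioo, ball_prod_same]
  have hcbox : closedBall p₀ ε = Icc (p₀.1 - ε) (p₀.1 + ε) ×ˢ Icc (p₀.2 - ε) (p₀.2 + ε) := by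
    rw [← Real.closedBall_eq_Icc, ← Real.closedBall_eq_Icc, closedBall_prod_same]
  -- the cutoff in `a`
  let η : ContDiffBump p₀.1 := ⟨ε / 2, 3 * ε / 4, by positivity, by linarith⟩
  have hrIn : η.rIn = ε / 2 := rfl
  have hrOut : η.rOut = 3 * ε / 4 := rfl
  have hη1 : ∀ a ∈ Ioo (p₀.1 - ε / 2) (p₀.1 + ε / 2), η a = 1 := fun a ha =>
    η.one_of_mem_closedBall (by
      rw [Real.closedBall_eq_Icc, hrIn]; exact ⟨ha.1.le, ha.2.le⟩)
  have hηs : tsupport η ⊆ I := by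
    rw [η.tsupport_eq, Real.closedBall_eq_Icc, hrOut, hI]
    intro a ha
    exact ⟨by linarith [ha.1], by linarith [ha.2]⟩
  -- the open set carrying the kernel
  set T : Set (ℝ × ℝ) := e.target ∩ e.symm ⁻¹' ball p₀ ε with hT
  have hTopen : IsOpen T := e.isOpen_inter_preimage_symm isOpen_ball
  set Θ₀ : ℝ × ℝ → ℝ := fun q => |d| * η q.1 * χ (e.symm q).2 / (d * D (e.symm q)) with hΘ₀
  set Θ : ℝ × ℝ → ℝ := T.indicator Θ₀ with hΘ
  -- basic facts
  have hΦat : ∀ q ∈ V, ContDiffAt ℝ ∞ Φ q := fun q hq => hΦ.contDiffAt (hV.mem_nhds hq)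
  have hDat : ∀ q ∈ V, ContDiffAt ℝ ∞ D q := fun q hq =>
    (((hΦ.fderiv_of_isOpen hV (by simp)).contDiffAt (hV.mem_nhds hq)).clm_apply contDiffAt_const)
  have hsymm_mem : ∀ q ∈ T, e.symm q ∈ ball p₀ ε := fun q hq => hq.2
  have hright : ∀ q ∈ T, ((e.symm q).1, Φ (e.symm q)) = q := fun q hq => by
    rw [← he]; exact e.right_inv hq.1
  have hmemT : ∀ p ∈ ball p₀ ε, (p.1, Φ p) ∈ T ∧ e.symm (p.1, Φ p) = p := by
    intro p hp
    have hps : p ∈ e.source := hsrc hp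
    have h1 : e.symm (p.1, Φ p) = p := by rw [← he]; exact e.left_inv hps
    refine ⟨⟨?_, ?_⟩, h1⟩
    · rw [← he]; exact e.map_source hps
    · show e.symm (p.1, Φ p) ∈ ball p₀ ε
      rwa [h1]
  -- support of the kernel
  have hsupp : ∀ q, Θ q ≠ 0 → q ∈ T ∧ (e.symm q).2 ∈ tsupport χ := by
    intro q hq
    have hqT : q ∈ T := by
      by_contra h
      exact hq (by rw [hΘ, indicator_of_notMem h])
    refine ⟨hqT, subset_tsupport _ ?_⟩
    intro h0
    apply hq
    rw [hΘ, indicator_of_mem hqT, hΘ₀]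
    simp [h0]
  have hsupp' : Function.support Θ ⊆
      (fun p : ℝ × ℝ => (p.1, Φ p)) '' (I ×ˢ tsupport χ) := by
    intro q hq
    obtain ⟨hqT, hq2⟩ := hsupp q hq
    refine ⟨e.symm q, ⟨?_, hq2⟩, hright q hqT⟩
    have := hsymm_mem q hqT
    rw [hbox] at this
    exact this.1
  -- smoothness on `T`
  have hΘ₀at : ∀ q ∈ T, ContDiffAt ℝ ∞ Θ₀ q := by
    intro q hq
    have hqb := hsymm_mem q hq
    have hqV : e.symm q ∈ V := hεV (ball_subset_closedBall hqb)
    have hs : ContDiffAt ℝ ∞ e.symm q := hsymm q hq.1 hqb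
    have h1 : ContDiffAt ℝ ∞ (fun q : ℝ × ℝ => |d| * η q.1) q :=
      contDiffAt_const.mul (η.contDiff.contDiffAt.comp q contDiffAt_fst)
    have h2 : ContDiffAt ℝ ∞ (fun q : ℝ × ℝ => χ (e.symm q).2) q :=
      hχ.contDiffAt.comp q (contDiffAt_snd.comp q hs)
    have h3 : ContDiffAt ℝ ∞ (fun q : ℝ × ℝ => d * D (e.symm q)) q :=
      contDiffAt_const.mul ((hDat _ hqV).comp q hs)
    have hne : d * D (e.symm q) ≠ 0 := (hpos _ (ball_subset_closedBall hqb)).ne'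
    exact (h1.mul h2).div h3 hne
  -- smoothness everywhere
  have hK : IsCompact ((fun p : ℝ × ℝ => (p.1, Φ p)) ''
      (Icc (p₀.1 - ε) (p₀.1 + ε) ×ˢ tsupport χ)) := by
    refine ((isCompact_Icc.prod hχc).image_of_continuousOn ?_)
    refine (continuousOn_fst.prodMk hΦ.continuousOn).mono ?_
    refine Subset.trans ?_ hεV
    rw [hcbox]
    exact prod_mono Subset.rfl (hχs.trans Ioo_subset_Icc_self)
  have hzero : ∀ q : ℝ × ℝ, q ∉ T → q.1 ∈ I → Θ =ᶠ[𝓝 q] 0 := by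
    intro q hqT hq1
    rw [← notMem_tsupport_iff_eventuallyEq]
    intro hmem
    have hsub : tsupport Θ ⊆ (fun p : ℝ × ℝ => (p.1, Φ p)) ''
        (Icc (p₀.1 - ε) (p₀.1 + ε) ×ˢ tsupport χ) :=
      closure_minimal (hsupp'.trans (image_mono (prod_mono Ioo_subset_Icc_self Subset.rfl)))
        hK.isClosed
    obtain ⟨p, ⟨hp1, hp2⟩, hpq⟩ := hsub hmem
    have hpa : p.1 = q.1 := by rw [← hpq]
    have hpb : p ∈ ball p₀ ε := by
      rw [hbox]
      exact ⟨hpa ▸ hq1, hχs hp2⟩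
    obtain ⟨hT', -⟩ := hmemT p hpb
    have hpq' : (p.1, Φ p) = q := hpq
    rw [hpq'] at hT'
    exact hqT hT'
  have hsmooth : ContDiff ℝ ∞ Θ := by
    rw [contDiff_iff_contDiffAt]
    intro q
    by_cases hq1 : q.1 ∈ I
    · by_cases hqT : q ∈ T
      · refine (hΘ₀at q hqT).congr_of_eventuallyEq ?_
        filter_upwards [hTopen.mem_nhds hqT] with q' hq'
        rw [hΘ, indicator_of_mem hq']
      · exact (contDiffAt_const (c := (0 : ℝ))).congr_of_eventuallyEq (hzero q hqT hq1)
    · have hη0 : (η : ℝ → ℝ) =ᶠ[𝓝 q.1] 0 :=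
        notMem_tsupport_iff_eventuallyEq.1 fun h => hq1 (hηs h)
      have hη0' : ∀ᶠ q' in 𝓝 q, η q'.1 = 0 := (continuous_fst.tendsto q).eventually hη0
      refine (contDiffAt_const (c := (0 : ℝ))).congr_of_eventuallyEq ?_
      filter_upwards [hη0'] with q' hq'
      rw [hΘ]
      by_cases hq'T : q' ∈ T
      · rw [indicator_of_mem hq'T, hΘ₀]
        simp [hq']
      · simp only [indicator_of_notMem hq'T]
  -- the bound
  obtain ⟨Cχ, hCχ⟩ := hχ.continuous.bounded_above_of_compact_support hχc
  have hDcont : ContinuousOn (fun q => d * D q) (closedBall p₀ ε) :=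
    (continuousOn_const.mul ((hΦ.continuousOn_fderiv_of_isOpen hV (by simp)).clm_apply
      continuousOn_const)).mono hεV
  obtain ⟨qm, hqm, hmin⟩ := (isCompact_closedBall p₀ ε).exists_isMinOn
    ⟨p₀, mem_closedBall_self hε.le⟩ hDcont
  set m : ℝ := d * D qm with hm
  have hm0 : 0 < m := hpos qm hqm
  have hC0 : 0 ≤ Cχ := (norm_nonneg _).trans (hCχ 0)
  have hbound : ∀ q, |Θ q| ≤ |d| * Cχ / m := by
    intro q
    by_cases hqT : q ∈ T
    · rw [hΘ, indicator_of_mem hqT, hΘ₀]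
      have hqb := hsymm_mem q hqT
      have hle : m ≤ d * D (e.symm q) := hmin (ball_subset_closedBall hqb)
      have hpos' : 0 < d * D (e.symm q) := hpos _ (ball_subset_closedBall hqb)
      have hη01 : |η q.1| ≤ 1 := by
        rw [abs_of_nonneg (η.nonneg)]; exact η.le_one
      have hχle : |χ (e.symm q).2| ≤ Cχ := by
        have := hCχ (e.symm q).2; simpa using this
      have hnum : |(|d| * η q.1 * χ (e.symm q).2)| ≤ |d| * Cχ := by
        rw [abs_mul, abs_mul, abs_abs]
        calc |d| * |η q.1| * |χ (e.symm q).2| ≤ |d| * 1 * Cχ :=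
              mul_le_mul (mul_le_mul_of_nonneg_left hη01 (abs_nonneg _)) hχle (abs_nonneg _)
                (by positivity)
          _ = |d| * Cχ := by ring
      rw [abs_div, abs_of_pos hpos']
      exact div_le_div₀ (by positivity) hnum hm0 hle
    · rw [hΘ, indicator_of_notMem hqT, abs_zero]
      positivity
  refine ⟨Θ, hsmooth, fun q hq => ?_, ⟨_, hbound⟩, fun a ha y hy => ?_, fun a ha u hu => ?_⟩
  · -- `u`-support
    obtain ⟨hqT, -⟩ := hsupp q hq
    refine ⟨e.symm q, ball_subset_closedBall (hsymm_mem q hqT), ?_⟩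
    have := hright q hqT
    exact (congrArg Prod.snd this)
  · -- the Jacobian identity
    have hay : (a, y) ∈ ball p₀ ε := by
      rw [hbox]; exact ⟨⟨by linarith [ha.1], by linarith [ha.2]⟩, hy⟩
    obtain ⟨hT', hs'⟩ := hmemT (a, y) hay
    have hpos' : 0 < d * D (a, y) := hpos _ (ball_subset_closedBall hay)
    have hDne : D (a, y) ≠ 0 := by
      intro h0; rw [h0, mul_zero] at hpos'; exact lt_irrefl _ hpos'
    have hdne : |d| ≠ 0 := abs_ne_zero.2 (by
      intro h0; rw [h0, zero_mul] at hpos'; exact lt_irrefl _ hpos')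
    show Θ (a, Φ (a, y)) * |D (a, y)| = χ y
    rw [hΘ, indicator_of_mem hT', hΘ₀]
    simp only [hs']
    rw [hη1 a ha, mul_one, ← abs_of_pos hpos', abs_mul, div_mul_eq_mul_div,
      div_eq_iff (mul_ne_zero hdne (abs_ne_zero.2 hDne))]
    ring
  · -- `u`-support on the good slices
    obtain ⟨hqT, -⟩ := hsupp (a, u) hu
    have hqb := hsymm_mem _ hqT
    have hr := hright _ hqT
    have h1 : (e.symm (a, u)).1 = a := congrArg Prod.fst hr
    refine ⟨(e.symm (a, u)).2, ?_, ?_⟩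
    · rw [hbox] at hqb; exact hqb.2
    · have h2 : Φ (e.symm (a, u)) = u := congrArg Prod.snd hr
      have h3 : (a, (e.symm (a, u)).2) = e.symm (a, u) := Prod.ext h1.symm rfl
      show Φ (a, (e.symm (a, u)).2) = u
      rw [h3]
      exact h2

/-- Inside the chart's source the slices `Φ (a, ·)` are injective on the `y`-window. -/
theorem injOn_slice {Φ : ℝ × ℝ → ℝ} {p₀ : ℝ × ℝ} {ε : ℝ}
    (e : OpenPartialHomeomorph (ℝ × ℝ) (ℝ × ℝ)) (hsrc : ball p₀ ε ⊆ e.source)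
    (he : ∀ q, e q = (q.1, Φ q)) :
    ∀ a ∈ Ioo (p₀.1 - ε) (p₀.1 + ε), InjOn (fun y => Φ (a, y)) (Ioo (p₀.2 - ε) (p₀.2 + ε)) := by
  intro a ha y₁ h₁ y₂ h₂ heq
  have hb : ∀ y ∈ Ioo (p₀.2 - ε) (p₀.2 + ε), (a, y) ∈ e.source := fun y hy => by
    apply hsrc
    rw [← ball_prod_same, Real.ball_eq_Ioo, Real.ball_eq_Ioo]
    exact ⟨ha, hy⟩
  have h := e.injOn (hb y₁ h₁) (hb y₂ h₂) (by rw [he, he]; exact Prod.ext rfl heq)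
  exact congrArg Prod.snd h

/-- **Chart and kernel, packaged** (the statement of helper stub B): injective slices on an
`ε`-box with closure in `V`, and for every admissible `χ` the smooth bounded compactly
`u`-supported Jacobian kernel `Θ`. -/
theorem exists_chart_kernel :
    ∀ (Φ : ℝ × ℝ → ℝ) (p₀ : ℝ × ℝ) (V : Set (ℝ × ℝ)), IsOpen V → p₀ ∈ V →
      ContDiffOn ℝ ((⊤ : ℕ∞) : WithTop ℕ∞) Φ V → fderiv ℝ Φ p₀ (0, 1) ≠ 0 →
      ∃ ε : ℝ, 0 < ε ∧ Metric.closedBall p₀ ε ⊆ V ∧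
        (∀ a ∈ Set.Ioo (p₀.1 - ε) (p₀.1 + ε),
          Set.InjOn (fun y => Φ (a, y)) (Set.Ioo (p₀.2 - ε) (p₀.2 + ε))) ∧
        ∀ χ : ℝ → ℝ, ContDiff ℝ ((⊤ : ℕ∞) : WithTop ℕ∞) χ → HasCompactSupport χ →
          tsupport χ ⊆ Set.Ioo (p₀.2 - ε) (p₀.2 + ε) →
          ∃ Θ : ℝ × ℝ → ℝ, ContDiff ℝ ((⊤ : ℕ∞) : WithTop ℕ∞) Θ ∧
            (∀ q, Θ q ≠ 0 → q.2 ∈ Φ '' Metric.closedBall p₀ ε) ∧ (∃ C : ℝ, ∀ q, |Θ q| ≤ C) ∧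
            (∀ a ∈ Set.Ioo (p₀.1 - ε / 2) (p₀.1 + ε / 2), ∀ y ∈ Set.Ioo (p₀.2 - ε) (p₀.2 + ε),
              Θ (a, Φ (a, y)) * |fderiv ℝ Φ (a, y) (0, 1)| = χ y) ∧
            (∀ a ∈ Set.Ioo (p₀.1 - ε / 2) (p₀.1 + ε / 2), ∀ u : ℝ, Θ (a, u) ≠ 0 →
              u ∈ (fun y => Φ (a, y)) '' Set.Ioo (p₀.2 - ε) (p₀.2 + ε)) := by
  intro Φ p₀ V hV hp₀ hΦ h2
  obtain ⟨ε, hε, e, hεV, hsrc, he, hpos, hsymm⟩ := exists_inverse_chart hV hp₀ hΦ h2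
  exact ⟨ε, hε, hεV, injOn_slice e hsrc he, fun χ hχ hχc hχs =>
    exists_kernel hV hΦ hε e hεV hsrc he hpos hsymm hχ hχc hχs⟩

end Summit.AtomisticToContinuum.FouriersLaw.Theorems.FGRGap.FoldJetRigidity.Bootstrap

namespace Summit.AtomisticToContinuum.FouriersLaw.Theorems.FGRGap.FoldJetRigidity

/-- **Helper stub B of `stub_nullVectorRegularity` (line fold-jet-rigidity).** For `Φ : ℝ² → ℝ`
smooth on an open `V ∋ p₀` with `∂₂Φ (p₀) ≠ 0`: an `ε`-box around `p₀` with closure in `V` on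
which the slices `Φ (a, ·)` are injective, and for every smooth `χ` compactly supported in the
`y`-window a smooth bounded kernel `Θ`, vanishing unless `u ∈ Φ (closed box)`, with
`Θ (a, Φ (a, y)) · |∂₂Φ (a, y)| = χ y` on the half-window in `a` and `Θ (a, u) ≠ 0` only for
`u ∈ Φ (a, window)` (inverse function theorem for `(a, y) ↦ (a, Φ (a, y))`). -/
theorem stub_nullVectorRegularity_partB :
    ∀ (Φ : ℝ × ℝ → ℝ) (p₀ : ℝ × ℝ) (V : Set (ℝ × ℝ)), IsOpen V → p₀ ∈ V → ContDiffOn ℝ ((⊤ : ℕ∞) : WithTop ℕ∞) Φ V → fderiv ℝ Φ p₀ (0, 1) ≠ 0 → ∃ ε : ℝ, 0 < ε ∧ Metric.closedBall p₀ ε ⊆ V ∧ (∀ a ∈ Set.Ioo (p₀.1 - ε) (p₀.1 + ε), Set.InjOn (fun y => Φ (a, y)) (Set.Ioo (p₀.2 - ε) (p₀.2 + ε))) ∧ ∀ χ : ℝ → ℝ, ContDiff ℝ ((⊤ : ℕ∞) : WithTop ℕ∞) χ → HasCompactSupport χ → tsupport χ ⊆ Set.Ioo (p₀.2 - ε) (p₀.2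 + ε) → ∃ Θ : ℝ × ℝ → ℝ, ContDiff ℝ ((⊤ : ℕ∞) : WithTop ℕ∞) Θ ∧ (∀ q, Θ q ≠ 0 → q.2 ∈ Φ '' Metric.closedBall p₀ ε) ∧ (∃ C : ℝ, ∀ q, |Θ q| ≤ C) ∧ (∀ a ∈ Set.Ioo (p₀.1 - ε / 2) (p₀.1 + ε / 2), ∀ y ∈ Set.Ioo (p₀.2 - ε) (p₀.2 + ε), Θ (a, Φ (a, y)) * |fderiv ℝ Φ (a, y) (0, 1)| = χ y) ∧ (∀ a ∈ Set.Ioo (p₀.1 - ε / 2) (p₀.1 + ε / 2), ∀ u : ℝ, Θ (a, u) ≠ 0 → u ∈ (fun y => Φ (a, y)) '' Set.Ioo (p₀.2 - ε) (p₀.2 + ε)) :=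
  Bootstrap.exists_chart_kernel

end Summit.AtomisticToContinuum.FouriersLaw.Theorems.FGRGap.FoldJetRigidity

end
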